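import Literature.NumberTheory.DiophantineGeometry.AbelianSchemeModelReductionTorsion
import Literature.AlgebraicGeometry.Morphisms.UnramifiedFiber
import Literature.AlgebraicGeometry.Motives.AbelianVarietyLie
import Literature.AlgebraicGeometry.Motives.AbelianVarietyTorsion
import Literature.AlgebraicGeometry.Motives.GoodReductionCechProofs
import Literature.AlgebraicGeometry.Limits.SurjectiveSpread
import Mathlib.AlgebraicGeometry.Fiber
import HarnessLib

/-!
# Serre–Tate §1 Lemma 2: the reduction map of an abelian-scheme model is a bijection on prime-to-`v` torsion

Topic `Literature/NumberTheory/DiophantineGeometry`; namespace `Literature.NumberTheory.DiophantineGeometry`.  THEOREMS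
ONLY (no definition, no named fact, no instance; debt 0).  Cell `hodgecm-mathlib`, programme «R-pkg» (lead B-p20), piece
T1c; completes `AbelianSchemeModelReductionTorsion` (T1a/T1b), whose only hypothesis `hunr` («`[N] : 𝒜 → 𝒜` is unramified»)
is DISCHARGED here.

Let `A / K` be an abelian variety over a number field, `v` a finite place, `𝒜 → Spec 𝓞_{K,v}` an abelian-scheme model
(`IsAbelianSchemeModel A v 𝒜`), `N` a natural number with `(N) ∉ v`, `[N] = (𝟙 𝒜) ^ N` (Mathlib's `Hom.group` power) and
`red_v = h.specialFibreReductionHom : A(K̄) → 𝒜_v(κ̄(v))`.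

* `IsAbelianSchemeModel.formallyUnramified_genericFibre_map_pow`, `…_specialFibreFunctor_map_pow` — `[N]` on the two
  FIBRES `𝒜_K ≅ A` and `𝒜_v = h.specialFibre` is unramified: it is `[N]` of an abelian variety over a field in which `N ≠ 0`,
  étale by the tree's `AbelianVariety.etale_zsmul_id_holds` ([MumfordAV1970] §6 Appl. 3; the generic fibre through the
  model's group isomorphism `h.exists_iso`, monoidal functors preserving `(𝟙 X)^N`).
* `IsAbelianSchemeModel.formallyUnramified_fiberToSpecResidueField_pow` — every scheme-theoretic fibre of `[N]_𝒜` over a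
  point `z ∈ 𝒜` is unramified: `z` lies in `𝒜_K` or in `𝒜_v` (the base has two points), the inclusion `g` of that fibre is
  surjective on stalks (base change of a localisation / of a closed immersion), so `κ(g y) ≅ κ(y)` and the fibre of `[N]_𝒜`
  over `g y` IS the fibre of `[N]_{fibre}` over `y` (Mathlib `isPullback_fiberToSpecResidueField_of_isPullback`), unramified
  by base change.
* `IsAbelianSchemeModel.formallyUnramified_pow_id_left` — **`[N]_𝒜` is unramified** ([BLRNeronModels1990] §7.3 Prop. 2),
  by A-p14's fibrewise criterion `FormallyUnramified.of_formallyUnramified_fiberToSpecResidueField` ([EGAIV4] 17.4.1,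
  Stacks 02G8) — and the `ℓⁿ`-family form `…_pow_id_left_pow` (= hypothesis `hunr` of R-pkg T7b).
* `IsAbelianSchemeModel.specialFibreReductionHom_injOn_geomTorsion`, `…_bijOn_geomTorsion` (+ `ℓⁿ` forms `…_pow`) —
  **[SerreTate1968GoodReduction] §1 Lemma 2, unconditionally: `red_v : A[N](K̄) → 𝒜_v[N](κ̄(v))` is a bijection for
  `(N) ∉ v`** (T1b `…_of_formallyUnramified` + T1a counting + the above).

HC_CM is proved only modulo the 7 printed citations until rung 0 closes.

## References
* [SerreTate1968GoodReduction] J.-P. Serre, J. Tate, *Good reduction of abelian varieties*, Ann. of Math. 88 (1968), §1 Lemma 2.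
* [BLRNeronModels1990] S. Bosch, W. Lütkebohmert, M. Raynaud, *Néron Models* (1990), §7.3 Prop. 2.
* [MumfordAV1970] D. Mumford, *Abelian Varieties* (1970), §6 Application 3 (Proposition p. 64).
* [EGAIV4] A. Grothendieck, EGA IV₄, Publ. Math. IHÉS 32 (1967), 17.3.3, 17.4.1.
* [GortzWedhorn2020] U. Görtz, T. Wedhorn, *Algebraic Geometry I* (2nd ed. 2020), (4.7) Prop. 4.16.
-/

set_option autoImplicit false

noncomputable section

open CategoryTheory CategoryTheory.Limits AlgebraicGeometry IsDedekindDomain IsDedekindDomain.HeightOneSpectrum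
open scoped NumberField MonObj CategoryTheory.Obj
open Literature.AlgebraicGeometry.Motives (AbelianVariety SchemeOver residueAt residueAt_surjective ker_residueAt)
open Literature.NumberTheory.EllipticCurves (genericFibre specGenericPoint)
open Literature.AlgebraicGeometry.Limits (isPullback_pullback_map_left)

namespace Literature.NumberTheory.DiophantineGeometry

universe u

/-! ### Generic lemmas -/

/-- Across a cartesian square `fst ≫ f = snd ≫ g` whose base-change map `g` is surjective on stalks, the fibre of `f` over
`g y` is isomorphic to the fibre of the base change `snd` over `y` (Mathlib `isPullback_fiberToSpecResidueField_of_isPullback`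
and `κ(g y) ≅ κ(y)`); so if `snd` is formally unramified, the fibre of `f` over `g y` is formally unramified (base change,
[EGAIV4] 17.3.3 (iii)). [cite: EGAIV4, Prop. 17.3.3 (iii)] -/
theorem formallyUnramified_fiberToSpecResidueField_of_isPullback {P X Y Z : Scheme.{u}} {fst : P ⟶ X}
    {snd : P ⟶ Y} {f : X ⟶ Z} {g : Y ⟶ Z} (H : IsPullback fst snd f g) (hg : SurjectiveOnStalks g)
    (hsnd' : FormallyUnramified snd) (y : Y) : FormallyUnramified (f.fiberToSpecResidueField (g.base y)) := by
  have sq := isPullback_fiberToSpecResidueField_of_isPullback H y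
  haveI := hg
  haveI := hsnd'
  -- `κ(g y) → κ(y)` is an isomorphism: a surjective homomorphism of fields
  haveI : IsIso (g.residueFieldMap y) := by
    have hsurj : Function.Surjective (g.residueFieldMap y) := by
      have h1 : Function.Surjective (Z.residue (g.base y) ≫ g.residueFieldMap y) := by
        rw [Scheme.residue_residueFieldMap]
        exact (Y.residue_surjective y).comp (g.stalkMap_surjective y)
      intro b
      obtain ⟨a, ha⟩ := h1 b
      exact ⟨Z.residue (g.base y) a, by simpa using ha⟩
    haveI : IsIso ((forget CommRingCat).map (g.residueFieldMap y)) :=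
      (isIso_iff_bijective _).mpr ⟨(g.residueFieldMap y).hom.injective, hsurj⟩
    exact isIso_of_reflects_iso (g.residueFieldMap y) (forget CommRingCat)
  obtain ⟨m, hw, hm⟩ : ∃ m : _ ⟶ _, m ≫ f.fiberToSpecResidueField (g.base y) =
      snd.fiberToSpecResidueField y ≫ Spec.map (g.residueFieldMap y) ∧ IsIso m :=
    ⟨_, sq.w, sq.isIso_fst_of_isIso⟩
  have hsnd : FormallyUnramified (snd.fiberToSpecResidueField y) := by
    rw [Scheme.Hom.fiberToSpecResidueField]
    exact MorphismProperty.pullback_snd (P := @FormallyUnramified) _ _ ‹_›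
  have heq : f.fiberToSpecResidueField (g.base y) =
      inv m ≫ snd.fiberToSpecResidueField y ≫ Spec.map (g.residueFieldMap y) := by
    rw [← hw, IsIso.inv_hom_id_assoc]
  rw [heq]
  exact MorphismProperty.comp_mem _ _ _ inferInstance (MorphismProperty.comp_mem _ _ _ hsnd inferInstance)

/-! ### The base `Spec 𝓞_{K,v}`: two points, two fibre inclusions -/

variable {K : Type} [Field K] [NumberField K] {v : HeightOneSpectrum (𝓞 K)}

/-- A point of `Spec 𝓞_{K,v}` is the generic point or the closed point (dimension one, local). [folklore] -/
private theorem asIdeal_eq_bot_or_eq_maximalIdeal (p : PrimeSpectrum (valuationSubringAtPrime K v)) :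
    p.asIdeal = ⊥ ∨ p.asIdeal = IsLocalRing.maximalIdeal (valuationSubringAtPrime K v) := by
  by_cases hp : p.asIdeal = ⊥
  · exact Or.inl hp
  · exact Or.inr (IsLocalRing.eq_maximalIdeal (p.isPrime.isMaximal hp))

/-- A point of an `𝓞_{K,v}`-scheme lying over the generic point is in the image of the generic fibre. [folklore] -/
private theorem exists_fst_specGenericPoint_eq (𝒳 : SchemeOver (valuationSubringAtPrime K v)) (z : 𝒳.left)
    (hz : (𝒳.hom.base z).asIdeal = ⊥) :
    ∃ y, (pullback.fst 𝒳.hom (specGenericPoint (valuationSubringAtPrime K v) K)).base y = z := by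
  have hmem : z ∈ Set.range ⇑(pullback.fst 𝒳.hom (specGenericPoint (valuationSubringAtPrime K v) K)) := by
    rw [Scheme.Pullback.range_fst]
    refine ⟨⟨⊥, Ideal.isPrime_bot⟩, ?_⟩
    apply PrimeSpectrum.ext
    rw [hz, Spec.map_apply, PrimeSpectrum.comap_asIdeal, CommRingCat.hom_ofHom,
      Ideal.comap_bot_of_injective _ (IsFractionRing.injective (valuationSubringAtPrime K v) K)]
  exact hmem

/-- A point of an `𝓞_{K,v}`-scheme lying over the closed point is in the image of the special fibre. [folklore] -/
private theorem exists_fst_specResidueField_eq (𝒳 : SchemeOver (valuationSubringAtPrime K v)) (z : 𝒳.left)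
    (hz : (𝒳.hom.base z).asIdeal = IsLocalRing.maximalIdeal (valuationSubringAtPrime K v)) :
    ∃ y, (pullback.fst 𝒳.hom (specResidueField v)).base y = z := by
  have hmem : z ∈ Set.range ⇑(pullback.fst 𝒳.hom (specResidueField v)) := by
    rw [Scheme.Pullback.range_fst]
    refine ⟨⟨⊥, Ideal.isPrime_bot⟩, ?_⟩
    apply PrimeSpectrum.ext
    rw [hz, Spec.map_apply, PrimeSpectrum.comap_asIdeal, CommRingCat.hom_ofHom, ← RingHom.ker_eq_comap_bot,
      ker_residueAt]
  exact hmem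

/-- The inclusion of the generic fibre is surjective on stalks (base change of a localisation). [folklore] -/
private theorem surjectiveOnStalks_fst_specGenericPoint (𝒳 : SchemeOver (valuationSubringAtPrime K v)) :
    SurjectiveOnStalks (pullback.fst 𝒳.hom (specGenericPoint (valuationSubringAtPrime K v) K)) := by
  haveI : IsPreimmersion (specGenericPoint (valuationSubringAtPrime K v) K) :=
    IsPreimmersion.of_isLocalization (nonZeroDivisors (valuationSubringAtPrime K v)) (S := K)
  exact MorphismProperty.pullback_fst (P := @SurjectiveOnStalks) _ _ inferInstance

/-- The inclusion of the special fibre is surjective on stalks (base change of a closed immersion). [folklore] -/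
private theorem surjectiveOnStalks_fst_specResidueField (𝒳 : SchemeOver (valuationSubringAtPrime K v)) :
    SurjectiveOnStalks (pullback.fst 𝒳.hom (specResidueField v)) := by
  haveI : IsClosedImmersion (specResidueField v) :=
    IsClosedImmersion.spec_of_surjective _ (residueAt_surjective v)
  exact MorphismProperty.pullback_fst (P := @SurjectiveOnStalks) _ _ inferInstance

/-! ### `[N]` on the two fibres of an abelian-scheme model is unramified -/

variable {A : AbelianVariety K} {𝒜 : SchemeOver (valuationSubringAtPrime K v)} [GrpObj 𝒜]

omit [NumberField K] in
/-- A natural number prime to `v` is non-zero in the residue field `κ(v)`. [folklore] -/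
private theorem natCast_residueField_ne_zero_of_not_mem' {N : ℕ} (hN : ((N : ℕ) : 𝓞 K) ∉ v.asIdeal) :
    (N : v.asIdeal.ResidueField) ≠ 0 := by
  rw [← map_natCast (algebraMap (𝓞 K) v.asIdeal.ResidueField) N, Ne, Ideal.algebraMap_residueField_eq_zero]
  exact hN

/-- A natural number prime to `v` is non-zero in `K`. [folklore] -/
private theorem natCast_ne_zero_of_not_mem {N : ℕ} (hN : ((N : ℕ) : 𝓞 K) ∉ v.asIdeal) : (N : K) ≠ 0 := by
  intro h0
  apply hN
  have : ((N : ℕ) : 𝓞 K) = 0 := by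
    apply IsFractionRing.injective (𝓞 K) K
    rw [map_natCast, map_zero, h0]
  rw [this]
  exact v.asIdeal.zero_mem

/-- A monoidal functor maps `[N] = (𝟙 X)^N` to `[N]` of the image group object. [folklore] -/
private theorem map_id_pow {C D : Type*} [Category C] [Category D] [CartesianMonoidalCategory C]
    [CartesianMonoidalCategory D] (F : C ⥤ D) [F.Monoidal] (X : C) [MonObj X] (N : ℕ) :
    F.map ((𝟙 X : X ⟶ X) ^ N) = (𝟙 (F.obj X) : F.obj X ⟶ F.obj X) ^ N := by
  rw [← F.homMonoidHom_apply, map_pow, F.homMonoidHom_apply, F.map_id]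

/-- **`[N]` on the special fibre of an abelian-scheme model is unramified** for `(N) ∉ v`: it is `[N]` of the
abelian variety `𝒜_v / κ(v)`, étale by `AbelianVariety.etale_zsmul_id_holds`. [cite: MumfordAV1970, §6 Application 3 (Proposition p. 64)] -/
theorem IsAbelianSchemeModel.formallyUnramified_specialFibreFunctor_map_pow (h : IsAbelianSchemeModel A v 𝒜)
    {N : ℕ} (hN : ((N : ℕ) : 𝓞 K) ∉ v.asIdeal) :
    FormallyUnramified ((specialFibreFunctor v).map ((𝟙 𝒜 : 𝒜 ⟶ 𝒜) ^ N)).left := by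
  have hN' : ((N : ℤ) : v.asIdeal.ResidueField) ≠ 0 := by
    rw [Int.cast_natCast]; exact natCast_residueField_ne_zero_of_not_mem' hN
  have het := AbelianVariety.etale_zsmul_id_holds (A := h.specialFibre) (N : ℤ) hN'
  have e1 : AbelianVariety.Hom.toSchemeHom ((N : ℤ) • 𝟙 h.specialFibre) =
      ((specialFibreFunctor v).map ((𝟙 𝒜 : 𝒜 ⟶ 𝒜) ^ N)).left := by
    change (((N : ℤ) • 𝟙 h.specialFibre).hom.hom.hom).left = _
    rw [AbelianVariety.hom_zsmul_id, zpow_natCast, map_id_pow]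
    rfl
  rw [e1] at het
  exact (Etale.iff_flat_and_formallyUnramified.mp het).2.1

/-- **`[N]` on the generic fibre of an abelian-scheme model is unramified** for `N ≠ 0` in `K`: it is conjugate
(by the model's generic iso) to `[N]` of `A`, étale by `AbelianVariety.etale_zsmul_id_holds`.
[cite: MumfordAV1970, §6 Application 3 (Proposition p. 64)] -/
theorem IsAbelianSchemeModel.formallyUnramified_genericFibre_map_pow (h : IsAbelianSchemeModel A v 𝒜)
    {N : ℕ} (hN : ((N : ℕ) : 𝓞 K) ∉ v.asIdeal) :
    FormallyUnramified ((genericFibre (valuationSubringAtPrime K v) K).map ((𝟙 𝒜 : 𝒜 ⟶ 𝒜) ^ N)).left := by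
  have hN' : ((N : ℤ) : K) ≠ 0 := by rw [Int.cast_natCast]; exact natCast_ne_zero_of_not_mem hN
  have het := AbelianVariety.etale_zsmul_id_holds (A := A) (N : ℤ) hN'
  obtain ⟨e, he⟩ := h.exists_iso
  haveI := he
  have h2 : (genericFibre (valuationSubringAtPrime K v) K).map ((𝟙 𝒜 : 𝒜 ⟶ 𝒜) ^ N) =
      e.hom ≫ ((N : ℤ) • 𝟙 A).hom.hom.hom ≫ e.inv := by
    rw [AbelianVariety.hom_zsmul_id, zpow_natCast, ← Category.assoc, Iso.eq_comp_inv, map_id_pow,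
      MonObj.pow_comp, MonObj.comp_pow, Category.id_comp, Category.comp_id]
  have e1 : ((genericFibre (valuationSubringAtPrime K v) K).map ((𝟙 𝒜 : 𝒜 ⟶ 𝒜) ^ N)).left =
      e.hom.left ≫ AbelianVariety.Hom.toSchemeHom ((N : ℤ) • 𝟙 A) ≫ e.inv.left := by
    rw [h2, Over.comp_left, Over.comp_left]
  haveI : IsIso e.hom.left := ⟨⟨e.inv.left, by rw [← Over.comp_left, e.hom_inv_id, Over.id_left],
    by rw [← Over.comp_left, e.inv_hom_id, Over.id_left]⟩⟩
  haveI : IsIso e.inv.left := ⟨⟨e.hom.left, by rw [← Over.comp_left, e.inv_hom_id, Over.id_left],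
    by rw [← Over.comp_left, e.hom_inv_id, Over.id_left]⟩⟩
  have hmid : FormallyUnramified (AbelianVariety.Hom.toSchemeHom ((N : ℤ) • 𝟙 A)) :=
    (Etale.iff_flat_and_formallyUnramified.mp het).2.1
  rw [e1]
  exact MorphismProperty.comp_mem _ _ _ inferInstance (MorphismProperty.comp_mem _ _ _ hmid inferInstance)

/-- **The fibres of `[N] : 𝒜 → 𝒜` are unramified** for an abelian-scheme model `𝒜` of `A` at `v` and `(N) ∉ v`:
every point `z` of `𝒜` lies in the generic fibre `𝒜_K` or in the special fibre `𝒜_v` (the base `Spec 𝓞_{K,v}` has two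
points); the fibre of `[N]_𝒜` over `z` is the fibre of `[N]_{𝒜_K}` resp. `[N]_{𝒜_v}` over the corresponding point
(cartesian square of the fibre inclusion, which induces isomorphisms on residue fields), and these are unramified
because `[N]` of the abelian varieties `A ≅ 𝒜_K` and `𝒜_v` is étale (`AbelianVariety.etale_zsmul_id_holds`).
This is the fibrewise input of BLR 7.3/2 («`[N]` is étale on an abelian scheme for `N` invertible on the base»).
[cite: BLRNeronModels1990, §7.3 Prop. 2] [cite: MumfordAV1970, §6 Application 3 (Proposition p. 64)] -/
theorem IsAbelianSchemeModel.formallyUnramified_fiberToSpecResidueField_pow (h : IsAbelianSchemeModel A v 𝒜)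
    {N : ℕ} (hN : ((N : ℕ) : 𝓞 K) ∉ v.asIdeal) (z : 𝒜.left) :
    FormallyUnramified ((((𝟙 𝒜 : 𝒜 ⟶ 𝒜) ^ N) : 𝒜 ⟶ 𝒜).left.fiberToSpecResidueField z) := by
  rcases asIdeal_eq_bot_or_eq_maximalIdeal (𝒜.hom.base z) with hz | hz
  · obtain ⟨y, rfl⟩ := exists_fst_specGenericPoint_eq 𝒜 z hz
    exact formallyUnramified_fiberToSpecResidueField_of_isPullback
      (isPullback_pullback_map_left (specGenericPoint (valuationSubringAtPrime K v) K)
        ((𝟙 𝒜 : 𝒜 ⟶ 𝒜) ^ N)).flip (surjectiveOnStalks_fst_specGenericPoint 𝒜)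
      (h.formallyUnramified_genericFibre_map_pow hN) y
  · obtain ⟨y, rfl⟩ := exists_fst_specResidueField_eq 𝒜 z hz
    exact formallyUnramified_fiberToSpecResidueField_of_isPullback
      (isPullback_pullback_map_left (specResidueField v) ((𝟙 𝒜 : 𝒜 ⟶ 𝒜) ^ N)).flip
      (surjectiveOnStalks_fst_specResidueField 𝒜) (h.formallyUnramified_specialFibreFunctor_map_pow hN) y

/-! ### `[N]` is unramified on the model; the reduction map is bijective on `N`-torsion -/

/-- **`[N] : 𝒜 → 𝒜` is unramified on an abelian-scheme model for `(N) ∉ v`** ([BLRNeronModels1990] §7.3 Prop. 2: «`[N]`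
is étale for `N` invertible on the base»; here the unramified half, which is all the torsion statements need): unramifiedness
is fibrewise (`FormallyUnramified.of_formallyUnramified_fiberToSpecResidueField`, [EGAIV4] 17.4.1 / Stacks 02G8) and the
fibres are unramified (`formallyUnramified_fiberToSpecResidueField_pow`). [cite: BLRNeronModels1990, §7.3 Prop. 2]
[cite: EGAIV4, Thm. 17.4.1] -/
theorem IsAbelianSchemeModel.formallyUnramified_pow_id_left (h : IsAbelianSchemeModel A v 𝒜) {N : ℕ}
    (hN : ((N : ℕ) : 𝓞 K) ∉ v.asIdeal) : FormallyUnramified (((𝟙 𝒜 : 𝒜 ⟶ 𝒜) ^ N) : 𝒜 ⟶ 𝒜).left := by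
  haveI : LocallyOfFiniteType (((𝟙 𝒜 : 𝒜 ⟶ 𝒜) ^ N) : 𝒜 ⟶ 𝒜).left := by
    have hw : (((𝟙 𝒜 : 𝒜 ⟶ 𝒜) ^ N) : 𝒜 ⟶ 𝒜).left ≫ 𝒜.hom = 𝒜.hom := Over.w _
    haveI := h.smooth
    haveI : Smooth 𝒜.hom := SmoothOfRelativeDimension.smooth A.dim 𝒜.hom
    haveI : LocallyOfFiniteType ((((𝟙 𝒜 : 𝒜 ⟶ 𝒜) ^ N) : 𝒜 ⟶ 𝒜).left ≫ 𝒜.hom) := by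
      rw [hw]; infer_instance
    exact locallyOfFiniteType_of_comp _ 𝒜.hom
  exact Literature.AlgebraicGeometry.Morphisms.FormallyUnramified.of_formallyUnramified_fiberToSpecResidueField _
    (h.formallyUnramified_fiberToSpecResidueField_pow hN)

/-- The `ℓⁿ` family form of `formallyUnramified_pow_id_left`: for `(ℓ) ∉ v`, every `[ℓⁿ] : 𝒜 → 𝒜` is unramified — the
hypothesis `hunr` of `AbelianVariety.exists_goodReductionAt_tateSpecialisation_of_formallyUnramified` (R-pkg T7b).
[cite: BLRNeronModels1990, §7.3 Prop. 2] -/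
theorem IsAbelianSchemeModel.formallyUnramified_pow_id_left_pow (h : IsAbelianSchemeModel A v 𝒜) {ℓ : ℕ}
    (hℓv : ((ℓ : ℕ) : 𝓞 K) ∉ v.asIdeal) (n : ℕ) :
    FormallyUnramified (((𝟙 𝒜 : 𝒜 ⟶ 𝒜) ^ (ℓ ^ n)) : 𝒜 ⟶ 𝒜).left :=
  h.formallyUnramified_pow_id_left (N := ℓ ^ n)
    (fun hmem => hℓv (v.isPrime.mem_of_pow_mem n (by simpa [Nat.cast_pow] using hmem)))

/-- **The reduction map `red_v : A[N](K̄) → 𝒜_v(κ̄(v))` is injective on `N`-torsion for `(N) ∉ v`**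
([SerreTate1968GoodReduction] §1 Lemma 2, injectivity): `specialFibreReductionHom_injOn_geomTorsion_of_formallyUnramified`
with `hunr` discharged by `formallyUnramified_pow_id_left`. [cite: SerreTate1968GoodReduction, §1 Lemma 2] -/
theorem IsAbelianSchemeModel.specialFibreReductionHom_injOn_geomTorsion (h : IsAbelianSchemeModel A v 𝒜) {N : ℕ}
    (hN : ((N : ℕ) : 𝓞 K) ∉ v.asIdeal) : Set.InjOn h.specialFibreReductionHom (A.geomTorsion (N : ℤ)) :=
  h.specialFibreReductionHom_injOn_geomTorsion_of_formallyUnramified N (h.formallyUnramified_pow_id_left hN)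

/-- **Serre–Tate, §1 Lemma 2: the reduction map is a bijection `A[N](K̄) ≃ 𝒜_v[N](κ̄(v))` for `(N) ∉ v`** — for an
abelian-scheme model `𝒜` of `A` at `v`, `red_v = h.specialFibreReductionHom` restricts to a bijection of the `N`-torsion
onto the `N`-torsion of the special fibre (`…_bijOn_geomTorsion_of_formallyUnramified` + `formallyUnramified_pow_id_left`).
[cite: SerreTate1968GoodReduction, §1 Lemma 2] -/
theorem IsAbelianSchemeModel.specialFibreReductionHom_bijOn_geomTorsion (h : IsAbelianSchemeModel A v 𝒜) {N : ℕ}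
    (hN : ((N : ℕ) : 𝓞 K) ∉ v.asIdeal) :
    Set.BijOn h.specialFibreReductionHom (A.geomTorsion (N : ℤ)) (h.specialFibre.geomTorsion (N : ℤ)) :=
  h.specialFibreReductionHom_bijOn_geomTorsion_of_formallyUnramified hN (h.formallyUnramified_pow_id_left hN)

/-- The `ℓⁿ` family form: for `(ℓ) ∉ v` and every `n`, `red_v` is injective on `A[ℓⁿ](K̄)` — the hypothesis `hinj` of
`AbelianVariety.exists_goodReductionAt_tateSpecialisation_of_injOn` (R-pkg T7b) and of the torsion/inertia/Tate-module
statements of `AbelianSchemeModelReductionInertia` / `TateModuleOfTorsionEquivs`. [cite: SerreTate1968GoodReduction, §1 Lemma 2] -/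
theorem IsAbelianSchemeModel.specialFibreReductionHom_injOn_geomTorsion_pow (h : IsAbelianSchemeModel A v 𝒜) {ℓ : ℕ}
    (hℓv : ((ℓ : ℕ) : 𝓞 K) ∉ v.asIdeal) (n : ℕ) :
    Set.InjOn h.specialFibreReductionHom (A.geomTorsion ((ℓ ^ n : ℕ) : ℤ)) :=
  h.specialFibreReductionHom_injOn_geomTorsion (N := ℓ ^ n)
    (fun hmem => hℓv (v.isPrime.mem_of_pow_mem n (by simpa [Nat.cast_pow] using hmem)))

/-- The `ℓⁿ` family form of the bijection: for `(ℓ) ∉ v` and every `n`, `red_v : A[ℓⁿ](K̄) → 𝒜_v[ℓⁿ](κ̄(v))` is a bijection.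
[cite: SerreTate1968GoodReduction, §1 Lemma 2] -/
theorem IsAbelianSchemeModel.specialFibreReductionHom_bijOn_geomTorsion_pow (h : IsAbelianSchemeModel A v 𝒜) {ℓ : ℕ}
    (hℓv : ((ℓ : ℕ) : 𝓞 K) ∉ v.asIdeal) (n : ℕ) :
    Set.BijOn h.specialFibreReductionHom (A.geomTorsion ((ℓ ^ n : ℕ) : ℤ))
      (h.specialFibre.geomTorsion ((ℓ ^ n : ℕ) : ℤ)) :=
  h.specialFibreReductionHom_bijOn_geomTorsion (N := ℓ ^ n)
    (fun hmem => hℓv (v.isPrime.mem_of_pow_mem n (by simpa [Nat.cast_pow] using hmem)))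

end Literature.NumberTheory.DiophantineGeometry

end
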